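import Literature.MathematicalPhysics.QuantumFieldTheory.Balaban1983to89.Node00.Record13SepCoPChi
import Literature.MathematicalPhysics.QuantumFieldTheory.Balaban1983to89.Node00.Record13ResidualsRChi
import Literature.MathematicalPhysics.QuantumFieldTheory.Balaban1983to89.Node00.Record13SepCoPRInhabitedOfSepCoP

/-!
# NODE 00 — K0 σ-CLOSURE χ-EDITIONS, SECOND TRANCHE, FILE F4∪F5 (dag-lead g40 WORDS 58x HANDS-3 H3.1; RR-2 g26 INTENT T2; one leaf per D-0064): THE ⁵→⁶→⁷ DOOR
# ROAD OF K0 RE-ISSUED GENERIC IN THE β-SLOT χ — the generic lift `Stage13RParams.provisos₁₃SepCoPRChi_of_sepCoPChi`, the CURED EMBEDDING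
# `Stage13RParams.ofCuredChi θ₀ χ := ⟨θ₀, ZrOfRecord₁₃Chi θ₀ χ⟩` with its faces (`zrUnity_ofCuredChi`, `Provisos₁₃SepCoPChi.ofCured`), the HISTORY-BLIND door
# `Stage13RParams.Provisos₁₃SepCoPRChi.ofHistoryBlind` (into [Ax-3d]'s `Stage13HParams.Provisos₁₃SepCoPHChi`), and the two K0-body lifts
# `exists_k0SepCoPR_of_exists_k0SepCoP_cmap ∕ exists_k0SepCoPH_of_exists_k0SepCoPR_cmap` over a CENTRE MAP `Χ : Stage13Params F N → ChiSlot F N` with their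
# RE-CENTRED instances `…_ax` (`Χ := chiβOfRecord₁₃Ax`), whose last conclusion is LITERALLY the body of K0ᴬ `Record13SepCoPHInhabitedAx` at `(F, N)`

CITATION HEADER.  [III] = [Balaban1988Convergent] (CMP **119**) (1.11) p.248, (2.12) p.256, (2.18) p.257, (2.21) p.258, (2.28) p.259, Thm 1 p.262, p.267,
(3.16)–(3.22) pp.268–269, (3.23)–(3.25) p.270; [IV] = [Balaban1989LargeFieldI] (0.2)–(0.4) p.176; [I] = [Balaban1987RG1] (0.19) p.255.  Every declaration below is
the VERBATIM body of the like-named declaration of `Node00/Record13SepCoPRInhabitedOfSepCoP.lean` (§1 :74, §2 :108–:166, §3 :182), `Node00/Record13SepCoPH.lean` (§H2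
:687 `Provisos₁₃SepCoPR.ofHistoryBlind`) and `Node00/Record13SepCoPInhabitedOfThm1CCMGaugeR.lean` (§2 :122 `exists_k0SepCoPH_of_exists_k0SepCoPR`) with EXACTLY the
substitutions of [Ax-3b∕3c∕3d] ∕ F1 ∕ F2∪F3 ∕ RR-2's `Node00/Record13ResidualsRChi` (`Provisos₁₃SepCoP ↦ Provisos₁₃SepCoPChi … χ`, `Provisos₁₃SepCoPR ↦ Provisos₁₃SepCoPRChi … χ`,
`Provisos₁₃SepCoPH ↦ Provisos₁₃SepCoPHChi … χ`, `SlotsNondegenerate₁₃ ↦ SlotsNondegenerate₁₃Chi … χ`, `ZrOfRecord₁₃ ↦ ZrOfRecord₁₃Chi … χ`, `ofCured ↦ ofCuredChi … χ`).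
THE ONE NON-VERBATIM POINT, DISPLAYED: in the two `∃ θ, …` K0 bodies the β-slot of the re-centred record is θ-DEPENDENT (`chiβOfRecord₁₃Ax F N θ := chiFixed29Ax F N θ.ν θ.ε₂₉`,
[Ax-3a]) — so the χ-generic lifts are stated over a CENTRE MAP `Χ : Stage13Params F N → ChiSlot F N` read at the witness (`Χ θ`, `Χ θ.toStage13Params`; CRIT-1 g33
RULING (d-i) «centre map», nodeO STATUS 00:56:49Z, of RR-2's class-layer design point I.21381), and instantiated at `Χ := chiβOfRecord₁₃Ax F N` (`…_ax`) and — as a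
receipt — at `Χ := chiβOfRecord₁₃ F N` (`exists_k0SepCoPH_of_exists_k0SepCoPR_cmap_chiβ`; the ⁵→⁶ lift at the record's centre map has LITERALLY the statement of the
landed `exists_k0SepCoPR_of_exists_k0SepCoP` — cited, not restated (gate dedup), its proof being `exists_k0SepCoPR_of_exists_k0SepCoP_cmap F (chiβOfRecord₁₃ F N)` through
the field-wise receipts `provisos₁₃SepCoP{,R}Chi_chiβ_iff`, `slotsNondegenerate₁₃Chi_chiβ_iff`).  dag-n07-w3 g22's σ-closure table
`SIGMA-CLOSURE-K0-V23-Ax.g22.md` (4ca252f7ab47910a), rows `Node00.Record13SepCoPRInhabitedOfSepCoP` (5: `exists_k0SepCoPR_of_exists_k0SepCoP`, `zrUnity_ofCured`,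
`ofCured` ×2, `provisos₁₃SepCoPR_of_sepCoP`), `Node00.Record13SepCoPH` (`ofHistoryBlind`) and `Node00.Record13SepCoPInhabitedOfThm1CCMGaugeR` (1:
`exists_k0SepCoPH_of_exists_k0SepCoPR`): all typed here.

Cell `pub-ymgap`, LADDER-YM R4 NODE 00, seat `pub-ymgap-node00-def-RR-2` g26.  `--kind definition --supports stmt-QuantumFields-27238` (K0ᴬ `Record13SepCoPHInhabitedAx`
door supply; count-neutral).  PURELY ADDITIVE: a NEW leaf; no source module edited (CRIT-1 g33 terms (α): body-freeze, new names only).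

HONEST SCOPE.  REDUCTIONS between typed hypothesis bodies (⁵ ⇒ ⁶ ⇒ ⁷ at general χ ∕ at a centre map ∕ at the re-centred slot) and `rfl` bookkeeping; nothing of
[III] ∕ [IV] ∕ [I] asserted or discharged; NO K0 body is inhabited here — K0ᴬ `stmt-QuantumFields-27238` is NOT closed (door supply only: its closer still owes a ⁵-level
inhabitant AT `χ := chiβOfRecord₁₃Ax`, i.e. row P11 `bg` and the core rows at the re-pinned witness — def-Y's ∕ the sockets' tranche); counts unmoved (typed 28∕28 ·
discharged 8∕28 · K 1∕4).  One finite `𝕋⁴` family at fixed `ε` — the route closes the conditional finite-𝕋⁴ rung `BalabanLadder.UV` only; NOT continuum ∕ ℝ⁴ ∕ OS;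
the Yang–Mills mass gap (Clay) is NOT proved.  No `instance`, no `notation`, no `sorry`.
-/

noncomputable section

open MeasureTheory
open scoped Matrix.Norms.L2Operator

namespace Literature.MathematicalPhysics.QuantumFieldTheory.Balaban1983to89.Node00

open T4Continuum AveragingRT T4FiniteEpsInhabited FlowStep FlowStepRuns DagBinding T4DatumAssembly
open B12Eq019ActionBody (integrand)

/-! ## §1. The generic ⁵→⁶ lift at any lawful run-indexed residual slot, generic in χ -/

section GenericLift

variable {F : T4Family} {N : ℕ} [NeZero N]

/-- **THE χ-GENERIC v1.6 SEPARATED-RANGE PROVISOS FROM THE χ-GENERIC v1.5 ONES AT ANY LAWFUL `Zr`** (rows verbatim at `θ.toStage13Params`; `zrLaws ∕ zrLocal` supplied;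
`provisos₁₃SepCoPR_of_sepCoP` verbatim). [cite: Balaban1988Convergent, (2.18) p.257, (2.28) p.259, (3.16) p.268, p.245, p.267 (bookkeeping)] -/
theorem Stage13RParams.provisos₁₃SepCoPRChi_of_sepCoPChi {θ : Stage13RParams F N} {χ : ChiSlot F N} (h : θ.toStage13Params.Provisos₁₃SepCoPChi F N χ)
    (hL : ∀ p : B12.RunParams, (θ.Zr p).Laws) (hLoc : ∀ p : B12.RunParams, (θ.Zr p).LocalLaws) : θ.Provisos₁₃SepCoPRChi F N χ where
  intPiece := h.intPiece
  measω := h.measω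
  measChi := h.measChi
  zetaUnity := h.zetaUnity
  zetaAbs := h.zetaAbs
  rstep := fun p k _ hk => h.rstep p k hk
  rzLaws := h.rzLaws
  zrLaws := hL
  zrLocal := hLoc
  hM := h.hM
  hM₁ := h.hM₁
  bg := h.bg
  zetaMeas := h.zetaMeas

end GenericLift

/-! ## §2. The CURED embedding `θ₀ ↦ ⟨θ₀, ZrOfRecord₁₃Chi θ₀ χ⟩` at the χ-thresholds, and its faces -/

section Cured

variable (F : T4Family) (N : ℕ) [NeZero N]

/-- **THE CURED EMBEDDING AT THE χ-THRESHOLDS** (`Stage13RParams.ofCured` verbatim with dag-n11-d's diagonal cure read at the χ-histories, RR-2's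
`ZrOfRecord₁₃Chi θ₀ χ`: at every generation `j < K` of the run, `ζ0_j(T) = w_j(s′_j(p))(V_j, V̄_j)`, complement on `∅`, `quad = 0`).  At `χ := chiβOfRecord₁₃ θ₀`
it IS `Stage13RParams.ofCured θ₀` (`ofCuredChi_chiβ`, `rfl`). [cite: Balaban1988Convergent, (1.11) p.248, (3.16)–(3.20) pp.268–269, p.267] -/
def Stage13RParams.ofCuredChi (θ₀ : Stage13Params F N) (χ : ChiSlot F N) : Stage13RParams F N :=
  ⟨θ₀, ZrOfRecord₁₃Chi F N θ₀ χ⟩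

/-- The cured embedding forgets to the parameter it came from (`rfl`). [cite: Balaban1988Convergent, (3.16) p.268 (bookkeeping)] -/
theorem Stage13RParams.ofCuredChi_toStage13Params (θ₀ : Stage13Params F N) (χ : ChiSlot F N) :
    (Stage13RParams.ofCuredChi F N θ₀ χ).toStage13Params = θ₀ := rfl

/-- The run-indexed slot of the cured embedding IS the χ-pin of record (`rfl`). [cite: Balaban1988Convergent, (1.11) p.248 (bookkeeping)] -/
theorem Stage13RParams.ofCuredChi_Zr (θ₀ : Stage13Params F N) (χ : ChiSlot F N) (p : B12.RunParams) :
    (Stage13RParams.ofCuredChi F N θ₀ χ).Zr p = ZrOfRecord₁₃Chi F N θ₀ χ p := rfl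

/-- Receipt: at the record's β-slot the χ-generic cured embedding IS the cured embedding of record (`rfl` through `ZrOfRecord₁₃Chi_chiβ`). [cite: Balaban1988Convergent, (1.11) p.248 (bookkeeping)] -/
theorem Stage13RParams.ofCuredChi_chiβ (θ₀ : Stage13Params F N) :
    Stage13RParams.ofCuredChi F N θ₀ (chiβOfRecord₁₃ F N θ₀) = Stage13RParams.ofCured F N θ₀ := rfl

variable {F N}

/-- **THE GUARD `ZrUnity` HOLDS AT THE χ-CURED EMBEDDING, hypothesis-free** (RR-2 `finsum_ζ0_ZrOfRecord₁₃_chi`). [cite: Balaban1988Convergent, (3.16)–(3.20) pp.268–269] -/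
theorem Stage13RParams.zrUnity_ofCuredChi (θ₀ : Stage13Params F N) (χ : ChiSlot F N) : (Stage13RParams.ofCuredChi F N θ₀ χ).ZrUnity F N :=
  fun p j ω => finsum_ζ0_ZrOfRecord₁₃_chi (θ := θ₀) (χ := χ) (p := p) j ω

/-- Admissibility at the χ-cured embedding IS `θ₀`'s (`Iff.rfl`). [cite: Balaban1988Convergent, (2.9) p.256 (bookkeeping)] -/
theorem Stage13RParams.admissible_ofCuredChi_iff {θ₀ : Stage13Params F N} {χ : ChiSlot F N} :
    (Stage13RParams.ofCuredChi F N θ₀ χ).Admissible F N ↔ θ₀.Admissible F N := Iff.rfl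

/-- χ-slot non-degeneracy at the χ-cured embedding IS `θ₀`'s (`Iff.rfl`). [cite: Balaban1988Convergent, (2.18) p.257 (bookkeeping)] -/
theorem Stage13RParams.slotsNondegenerate₁₃Chi_ofCuredChi_iff {θ₀ : Stage13Params F N} {χ χ' : ChiSlot F N} :
    (Stage13RParams.ofCuredChi F N θ₀ χ).SlotsNondegenerate₁₃Chi F N χ' ↔ θ₀.SlotsNondegenerate₁₃Chi F N χ' := Iff.rfl

/-- **THE χ-GENERIC v1.5 SEPARATED-RANGE PROVISOS GIVE THE χ-GENERIC v1.6 ONES AT THE χ-CURED EMBEDDING** (`zrLaws` by RR-2 `laws_ZrOfRecord₁₃_chi` from the row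
`zetaUnity`; `zrLocal` by `localLaws_ZrOfRecord₁₃_chi`; `Provisos₁₃SepCoP.ofCured` verbatim). [cite: Balaban1988Convergent, (2.18) p.257, (2.28) p.259, (3.16) p.268, p.267 (bookkeeping)] -/
theorem Stage13Params.Provisos₁₃SepCoPChi.ofCured {θ₀ : Stage13Params F N} {χ : ChiSlot F N} (h : θ₀.Provisos₁₃SepCoPChi F N χ) :
    (Stage13RParams.ofCuredChi F N θ₀ χ).Provisos₁₃SepCoPRChi F N χ :=
  Stage13RParams.provisos₁₃SepCoPRChi_of_sepCoPChi (θ := Stage13RParams.ofCuredChi F N θ₀ χ) h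
    (fun p => laws_ZrOfRecord₁₃_chi (θ := θ₀) (χ := χ) (p := p) h.zetaUnity) (fun p => localLaws_ZrOfRecord₁₃_chi (θ := θ₀) (χ := χ) (p := p))

variable (F N)

/-- **The cured embedding, RE-CENTRED** (instance `χ := chiβOfRecord₁₃Ax θ₀`, [Ax-3a]). [cite: Balaban1988Convergent, (1.11) p.248, (3.16)–(3.20) pp.268–269] -/
abbrev Stage13RParams.ofCuredAx (θ₀ : Stage13Params F N) : Stage13RParams F N := Stage13RParams.ofCuredChi F N θ₀ (chiβOfRecord₁₃Ax F N θ₀)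

end Cured

/-! ## §3. The history-blind door ⁶→⁷, generic in χ (into [Ax-3d]'s `Stage13HParams.Provisos₁₃SepCoPHChi`) -/

section HistoryBlind

variable {F : T4Family} {N : ℕ} [NeZero N]

/-- **THE χ-GENERIC v1.6 PROVISOS GIVE THE χ-GENERIC v1.7 PROVISOS AT THE HISTORY-BLIND EMBEDDING** (node00-def-T's `Stage13HParams.ofHistoryBlind θ`; rows verbatim
incl. `hM`, `hM₁`, `bg`, `zetaMeas`; `zhLaws p n Ω Λ := zrLaws p`, `zhLocal p n Ω Λ := zrLocal p`; `Provisos₁₃SepCoPR.ofHistoryBlind` verbatim).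
[cite: Balaban1988Convergent, (2.21) p.258, (3.16) p.268, p.259 (bookkeeping)] -/
theorem Stage13RParams.Provisos₁₃SepCoPRChi.ofHistoryBlind {θ : Stage13RParams F N} {χ : ChiSlot F N} (h : θ.Provisos₁₃SepCoPRChi F N χ) :
    (Stage13HParams.ofHistoryBlind F N θ).Provisos₁₃SepCoPHChi F N χ where
  intPiece := h.intPiece
  measω := h.measω
  measChi := h.measChi
  zetaUnity := h.zetaUnity
  zetaAbs := h.zetaAbs
  rstep := fun p k _ hk => h.rstep p k hk
  rzLaws := h.rzLaws
  zhLaws := fun p _ _ _ => h.zrLaws p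
  zhLocal := fun p _ _ _ => h.zrLocal p
  hM := h.hM
  hM₁ := h.hM₁
  bg := h.bg
  zetaMeas := h.zetaMeas

/-- The forgetful projection of the history-blind embedding (`rfl`; the χ-slot arguments `Χ θ.toStage13Params` below compute through it).
[cite: Balaban1988Convergent, (3.16) p.268 (bookkeeping)] -/
theorem Stage13HParams.ofHistoryBlind_toStage13Params (θ : Stage13RParams F N) :
    (Stage13HParams.ofHistoryBlind F N θ).toStage13Params = θ.toStage13Params := rfl

end HistoryBlind

/-! ## §4. ★★★ The K0 bodies along the door road, generic over a CENTRE MAP `Χ`, and RE-CENTRED -/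

section K0LiftR

variable (F : T4Family) {N : ℕ} [NeZero N]

/-- **★★★ THE v1.6 K0 BODY FROM THE v1.5 K0 BODY AT THE CURED PIN, OVER A CENTRE MAP `Χ`** (`exists_k0SepCoPR_of_exists_k0SepCoP` verbatim with the β-slot read at
the witness, `Χ θ`): a v1.5 inhabitant `θ₀` (provisos `Provisos₁₃SepCoPChi θ₀ (Χ θ₀)`, guards `ZtUnity ∧ SlotsNondegenerate₁₃Chi θ₀ (Χ θ₀)`, admissible) yields the v1.6
inhabitant `Stage13RParams.ofCuredChi θ₀ (Χ θ₀)` (provisos by §2, `ZrUnity` hypothesis-free, the other guard and admissibility read `θ₀`; `ZtUnity` is not used).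
A REDUCTION — nothing of Bałaban asserted. [cite: Balaban1988Convergent, Thm 1 p.262, (1.11) p.248, (2.12) p.256, (2.28) p.259, (3.16)–(3.22) pp.268–269] -/
theorem exists_k0SepCoPR_of_exists_k0SepCoP_cmap (Χ : Stage13Params F N → ChiSlot F N)
    (h : ∃ θ : Stage13Params F N, θ.Provisos₁₃SepCoPChi F N (Χ θ) ∧ (θ.ZtUnity F N ∧ θ.SlotsNondegenerate₁₃Chi F N (Χ θ)) ∧ θ.Admissible F N) :
    ∃ θ : Stage13RParams F N, θ.Provisos₁₃SepCoPRChi F N (Χ θ.toStage13Params) ∧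
      (θ.ZrUnity F N ∧ θ.SlotsNondegenerate₁₃Chi F N (Χ θ.toStage13Params)) ∧ θ.Admissible F N := by
  obtain ⟨θ₀, hP, ⟨_, hS⟩, hA⟩ := h
  exact ⟨Stage13RParams.ofCuredChi F N θ₀ (Χ θ₀), hP.ofCured, ⟨Stage13RParams.zrUnity_ofCuredChi θ₀ (Χ θ₀), hS⟩, hA⟩

/-- **THE v1.6 K0 BODY FROM THE v1.5 K0 BODY, RE-CENTRED** (instance `Χ := chiβOfRecord₁₃Ax F N` of `exists_k0SepCoPR_of_exists_k0SepCoP_cmap`: the ⁵→⁶ door of the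
K0ᴬ road). [cite: Balaban1988Convergent, Thm 1 p.262, (1.11) p.248, (2.28) p.259, (3.16)–(3.22) pp.268–269] -/
theorem exists_k0SepCoPR_of_exists_k0SepCoP_ax
    (h : ∃ θ : Stage13Params F N, θ.Provisos₁₃SepCoPAx F N ∧ (θ.ZtUnity F N ∧ θ.SlotsNondegenerate₁₃Ax F N) ∧ θ.Admissible F N) :
    ∃ θ : Stage13RParams F N, θ.Provisos₁₃SepCoPRAx F N ∧ (θ.ZrUnity F N ∧ θ.SlotsNondegenerate₁₃Ax F N) ∧ θ.Admissible F N :=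
  exists_k0SepCoPR_of_exists_k0SepCoP_cmap F (chiβOfRecord₁₃Ax F N) h

end K0LiftR

section K0LiftH

variable {F : T4Family} {N : ℕ} [NeZero N]

/-- **★★★ THE v1.7 K0 BODY FROM THE v1.6 K0 BODY ALONG THE HISTORY-BLIND DOOR, OVER A CENTRE MAP `Χ`** (`exists_k0SepCoPH_of_exists_k0SepCoPR` verbatim with the
β-slot read at the witness, `Χ θ.toStage13Params`: v1.6 provisos give v1.7 provisos (§3), `ZrUnity` gives `ZhUnity`, the χ-slot guard and admissibility are read
through `toStage13RParams`).  A REDUCTION — nothing of Bałaban asserted. [cite: Balaban1988Convergent, (2.21) p.258, (3.16)–(3.20) pp.268–269, (3.23) p.270; Balaban1989LargeFieldI, (0.2)–(0.4) p.176 (bookkeeping)] -/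
theorem exists_k0SepCoPH_of_exists_k0SepCoPR_cmap (Χ : Stage13Params F N → ChiSlot F N)
    (h : ∃ θ : Stage13RParams F N, θ.Provisos₁₃SepCoPRChi F N (Χ θ.toStage13Params) ∧
      (θ.ZrUnity F N ∧ θ.SlotsNondegenerate₁₃Chi F N (Χ θ.toStage13Params)) ∧ θ.Admissible F N) :
    ∃ θ : Stage13HParams F N, θ.Provisos₁₃SepCoPHChi F N (Χ θ.toStage13Params) ∧
      (θ.ZhUnity F N ∧ θ.SlotsNondegenerate₁₃Chi F N (Χ θ.toStage13Params)) ∧ θ.Admissible F N := by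
  obtain ⟨θ, hP, ⟨hU, hS⟩, hA⟩ := h
  exact ⟨Stage13HParams.ofHistoryBlind F N θ, hP.ofHistoryBlind, ⟨hU.ofHistoryBlind, hS⟩, hA⟩

/-- **★★★ THE v1.7 K0 BODY FROM THE v1.6 K0 BODY, RE-CENTRED** (instance `Χ := chiβOfRecord₁₃Ax F N` of `exists_k0SepCoPH_of_exists_k0SepCoPR_cmap`: the ⁶→⁷ door of the
K0ᴬ road — its conclusion is LITERALLY the body of K0ᴬ `Record13SepCoPHInhabitedAx` at `(F, N)`). CONDITIONAL on a ⁶-level re-centred inhabitant; K0ᴬ NOT closed here.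
[cite: Balaban1988Convergent, Thm 1 p.262, (2.21) p.258, (3.16)–(3.20) pp.268–269, (3.23) p.270; Balaban1989LargeFieldI, (0.2)–(0.4) p.176 (bookkeeping)] -/
theorem exists_k0SepCoPH_of_exists_k0SepCoPR_ax
    (h : ∃ θ : Stage13RParams F N, θ.Provisos₁₃SepCoPRAx F N ∧ (θ.ZrUnity F N ∧ θ.SlotsNondegenerate₁₃Ax F N) ∧ θ.Admissible F N) :
    ∃ θ : Stage13HParams F N, θ.Provisos₁₃SepCoPHAx F N ∧ (θ.ZhUnity F N ∧ θ.SlotsNondegenerate₁₃Ax F N) ∧ θ.Admissible F N :=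
  exists_k0SepCoPH_of_exists_k0SepCoPR_cmap (chiβOfRecord₁₃Ax F N) h

/-- **★★★ THE v1.7 K0 BODY FROM THE v1.5 K0 BODY, RE-CENTRED — THE WHOLE ⁵→⁶→⁷ DOOR OF THE K0ᴬ ROAD IN ONE TERM** (`…_ax` ∘ `…_ax`). CONDITIONAL on a ⁵-level re-centred
inhabitant (row P11 `bg` and the core rows at the re-pinned witness — NOT supplied here); K0ᴬ NOT closed here. [cite: Balaban1988Convergent, Thm 1 p.262, (1.11) p.248, (2.28) p.259, (3.16)–(3.23) pp.268–270 (bookkeeping)] -/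
theorem exists_k0SepCoPH_of_exists_k0SepCoP_ax
    (h : ∃ θ : Stage13Params F N, θ.Provisos₁₃SepCoPAx F N ∧ (θ.ZtUnity F N ∧ θ.SlotsNondegenerate₁₃Ax F N) ∧ θ.Admissible F N) :
    ∃ θ : Stage13HParams F N, θ.Provisos₁₃SepCoPHAx F N ∧ (θ.ZhUnity F N ∧ θ.SlotsNondegenerate₁₃Ax F N) ∧ θ.Admissible F N :=
  exists_k0SepCoPH_of_exists_k0SepCoPR_ax (exists_k0SepCoPR_of_exists_k0SepCoP_ax F h)

/-- Receipt: at the centre map of record `Χ := chiβOfRecord₁₃ F N` the χ-generic ⁶→⁷ door IS the door of record's statement (through the field-wise receipts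
`provisos₁₃SepCoPRChi_chiβ_iff`, [Ax-3d] `provisos₁₃SepCoPHChi_chiβ_iff`, [Ax-3b] `slotsNondegenerate₁₃Chi_chiβ_iff`). [cite: Balaban1988Convergent, Thm 1 p.262 (bookkeeping)] -/
theorem exists_k0SepCoPH_of_exists_k0SepCoPR_cmap_chiβ
    (h : ∃ θ : Stage13RParams F N, θ.Provisos₁₃SepCoPR F N ∧ (θ.ZrUnity F N ∧ θ.SlotsNondegenerate₁₃ F N) ∧ θ.Admissible F N) :
    ∃ θ : Stage13HParams F N, θ.Provisos₁₃SepCoPH F N ∧ (θ.ZhUnity F N ∧ θ.SlotsNondegenerate₁₃ F N) ∧ θ.Admissible F N := by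
  obtain ⟨θ₀, hP, ⟨hU, hS⟩, hA⟩ := h
  obtain ⟨θ, hP', ⟨hU', hS'⟩, hA'⟩ := exists_k0SepCoPH_of_exists_k0SepCoPR_cmap (chiβOfRecord₁₃ F N)
    ⟨θ₀, (provisos₁₃SepCoPRChi_chiβ_iff θ₀).2 hP, ⟨hU, (slotsNondegenerate₁₃Chi_chiβ_iff θ₀.toStage13Params).2 hS⟩, hA⟩
  exact ⟨θ, (provisos₁₃SepCoPHChi_chiβ_iff θ).1 hP', ⟨hU', (slotsNondegenerate₁₃Chi_chiβ_iff θ.toStage13Params).1 hS'⟩, hA'⟩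

end K0LiftH

end Literature.MathematicalPhysics.QuantumFieldTheory.Balaban1983to89.Node00

end
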